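import Summits.QuantumFields.BalabanUV.T4Continuum.Support.SubstrateExpChartLog
import Literature.MathematicalPhysics.QuantumFieldTheory.Balaban1983to89.BlockAveragingExpMeanLog
import Literature.MathematicalPhysics.QuantumLattice.GaugeGroups

/-!
# SUBSTRATE — W-24b = LIBRARY L-E18b PART 1 (typer (π1), `HOME/CLAIMS.log` l.23183): THE COMPLEX (0.4) ONE-STEP BLOCK AVERAGE ON TWO-SIDED MATRIX DATA —
# the loop words of [Balaban1987RG1] (0.4) re-read on pairs `(R, S)` (forward step ↦ `R b`, backward step ↦ `S b`), the exp-mean-log correction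
# `eml` of the tree (`BlockAveragingExpMeanLog` §7) WITHOUT the small-field guard, the REAL TIE with `BlockAveraging.blockAvg ℰ` on small fields,
# HOLOMORPHY along analytic two-sided families, and — through W-24a's logarithmic chart `SubstrateExpChartLog.logChart` — the ONE-STEP chart coordinate
# of the complex average of the fine-field slice relative to the real average: `= 0` at `z = 0` (letter (1)) and HOLOMORPHIC there (letter (2′)) — piece
# (P) + (T) + (C∘P) of the scope of record at ONE step; the tower iteration and the depth disc (letter (3)) are later files

Cell `pub-balaban`, SUBSTRATE cell, seat `b2b-balaban-substrate-p2` (gen 6).  Numbered by typer (ο9-2)(c) ∕ (π1) («THIS SHAPE», l.23183) on the event W-22′ READ (l.22977) ∧ W-24a LANDED (p240014); the sequel parts are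
W-24c = L-E18b PART 2 (tower iteration + depth disc) and W-24d = L-E18b PART 3 (the `FineFieldChart` inhabitant).  Summits-side under the LEAN PLACEMENT RULE; [folklore] algebra over the tree's (0.4) vocabulary BY NAME (`BlockAveraging.loopWord ∕ Idx ∕ off ∕ loopHol ∕
corr ∕ avgFun ∕ blockAvg ∕ Small`, `T4Continuum.walk ∕ holAt ∕ axialAvg_eq_holAt_walk`, `LoopAverage.avg ∕ enum`, `ExpMeanLog.eml ∕ eml_eq_exp ∕ analyticAt_eml`,
`expMeanLogSU ∕ coe_ESU_of_small`, `fundamentalRep`) and W-24a `SubstrateExpChartLog.logChart ∕ analyticAt_logChart_apply` (p4 g5) BY NAME; nothing printed is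
asserted beyond what those modules PROVE; no citation tags.

HONEST FRAMING: rung (B)+1 of the FINITE-VOLUME T⁴ programme — NOT infinite volume, NOT a mass gap, NOT Clay; spine PROVED 0∕9; a CONSTRUCTION (the
complexification of the averaging of record at one step) + its analyticity BY NAME — NO estimate of any NE row; nothing of [Balaban1985Averaging] asserted.
HONEST DEPENDENCY (cell line, verbatim): continuum YM on T⁴ ⇐ BetaPertH ∧ nine spine estimates (0/9 proved); BetaPertH ⇐ (D1) ∧ (D4) ∧ CAP+tail; G-an2-4
gates asym, D1 and NE2/3/4.

WHAT.
* §1 `holRS R S γ` — the two-sided holonomy along an oriented step list in any monoid; `holRS_nil ∕ _cons ∕ _append`; **`holRS_hom_eq`** (`R := ι ∘ U`,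
  `S := ι ∘ U⁻¹` for a monoid hom `ι : G →* 𝔸` ⇒ `holRS R S γ = ι (holAt U γ)` — the REAL TIE of the words); **`analyticAt_holRS`** (finite product of analytic
  factors), `continuousAt_holRS`.
* §2 the complex (0.4) step on two-sided data: `loopHolRS R S c i`, `axialRS R S c`, **`corrRS R S c := eml (loopHolRS R S c)`** (NO guard — used inside the small
  window), **`avgRS R S c := corrRS R S c * axialRS R S c`**; `eml_comp_equiv'` (reindexing `eml` along an `Equiv` of index types); ties `loopHolRS_hom_eq`,
  `axialRS_hom_eq`; **`corrRS_hom_eq_of_small`** ∕ **`avgRS_hom_eq_of_small`** for ANY `LoopAverage ℰ` whose `E` reads `eml` after `ι` on small families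
  (hypothesis `hE`, displayed) under `Small ℰ U c`; **`fundamentalRep_expMeanLogSU_E`** discharges `hE` for `SU(n)` with `ι := fundamentalRep n` (tree
  `coe_ESU_of_small`), whence **`avgRS_fundamentalRep_eq_blockAvg`**: on small fields the complex step IS the (0.4) average OF RECORD
  `BlockAveraging.blockAvg expMeanLogSU` read through the fundamental representation.
* §3 holomorphy: **`analyticAt_corrRS`**, **`analyticAt_avgRS`** along any analytic two-sided family at a parameter whose loop variables are 1-small
  (`ExpMeanLog.analyticAt_eml` BY NAME); the fine-field slice of record `sliceR ι U H z b := exp (z • H b) * ι (U b)`, `sliceS ι U H z b := ι (U b)⁻¹ * exp (−(z • H b))`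
  (`sliceR_zero ∕ sliceS_zero`, `sliceR_mul_sliceS` — the two sides ARE inverse along the slice —, `analyticAt_sliceR ∕ _sliceS`), and **`analyticAt_avgRS_slice`**: the complex (0.4) average of the slice is holomorphic in `z` at
  every `z₀` where the slice's loop variables at `c` are 1-small — in particular at `z₀ = 0` on `Small` fields (`analyticAt_avgRS_slice_zero`).
* §4 THE ONE-STEP CHART COORDINATE (matrices; W-24a's `logChart` BY NAME): `asLevel` (bond data as `Fin d → Site → Matrix`), **`stepCoord ℰ ι U H z :=
  logChart (asLevel (ι ∘ M(U))) (asLevel (avgRS (sliceR z) (sliceS z)))`**, `avgRS_slice_zero` (the tie at `z = 0`), **`stepCoord_zero_apply`** (LETTER (1) at one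
  step: `= 0` at `z = 0`), **`analyticAt_stepCoord_zero`** (LETTER (2′) at one step: holomorphic at `z = 0`) — hypotheses `ℰ.δ ≤ 1`, `ι` unitary-valued,
  `‖ι g − 1‖ = dist1 g`, `hE` DISPLAYED — and their `SU(n)` discharges **`stepCoord_zero_apply_SU`** ∕ **`analyticAt_stepCoord_zero_SU`** at
  `ℰ := expMeanLogSU`, `ι := fundamentalRep n` (every hypothesis PROVED: `deltaSU ≤ 1∕3`, `fundamentalRep_mem_unitaryGroup`, `dist1 = ‖· − 1‖` by `rfl`).
0 sorry; axioms ⊆ {propext, Classical.choice, Quot.sound}.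
-/

noncomputable section

open scoped Matrix.Norms.L2Operator BigOperators

namespace Summit.QuantumFields.BalabanUV.T4Continuum.SubstrateComplexBlockAvg

open Literature.MathematicalPhysics.QuantumFieldTheory.Balaban1983to89
open Literature.MathematicalPhysics.QuantumFieldTheory.Balaban1983to89.T4Continuum (LStep holAt walk loopWord axialAvg_eq_holAt_walk)
open Literature.MathematicalPhysics.QuantumFieldTheory.Balaban1983to89.BlockAveraging (Idx off loopHol corr avgFun blockAvg Small)
open Literature.MathematicalPhysics.QuantumFieldTheory.Balaban1983to89.ExpMeanLog (eml eml_eq_exp analyticAt_eml expMeanLogSU coe_ESU_of_small)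
open Literature.MathematicalPhysics.QuantumLattice (fundamentalRep)

variable {P : Params} {j : ℕ}

/-! ## §1 Two-sided holonomy along oriented step lists -/

/-- [folklore] **THE TWO-SIDED HOLONOMY** of a pair of bond data `(R, S)` along an oriented step list: forward steps read `R`, backward steps read `S`
(on real data `S = R⁻¹`; on complex data `S` is the displayed inverse-side, so NO inversion of a variable ever occurs — the substrate's `(R, S)` convention). -/
def holRS {𝔸 : Type*} [Monoid 𝔸] (R S : PBond P j → 𝔸) (γ : List (LStep P j)) : 𝔸 :=
  (γ.map fun s => if s.fwd then R s.bond else S s.bond).prod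

/-- [folklore] Empty word. -/
@[simp] theorem holRS_nil {𝔸 : Type*} [Monoid 𝔸] (R S : PBond P j → 𝔸) : holRS R S [] = 1 := by simp [holRS]

/-- [folklore] One step more. -/
theorem holRS_cons {𝔸 : Type*} [Monoid 𝔸] (R S : PBond P j → 𝔸) (s : LStep P j) (γ : List (LStep P j)) :
    holRS R S (s :: γ) = (if s.fwd then R s.bond else S s.bond) * holRS R S γ := by simp [holRS]

/-- [folklore] Concatenation of words. -/
theorem holRS_append {𝔸 : Type*} [Monoid 𝔸] (R S : PBond P j → 𝔸) (γ γ' : List (LStep P j)) :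
    holRS R S (γ ++ γ') = holRS R S γ * holRS R S γ' := by simp [holRS, List.map_append, List.prod_append]

/-- [folklore] **REAL TIE OF THE WORDS**: on group-valued data read through a monoid hom `ι` with the inverse side `S := ι ∘ U⁻¹`, the two-sided holonomy IS
`ι` of the tree's holonomy `T4Continuum.holAt`. -/
theorem holRS_hom_eq {G : Type*} [GaugeGroup G] {𝔸 : Type*} [Monoid 𝔸] (ι : G →* 𝔸) (U : GaugeField P j G) (γ : List (LStep P j)) :
    holRS (fun b => ι (U b)) (fun b => ι (U b)⁻¹) γ = ι (holAt U γ) := by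
  induction γ with
  | nil => simp [holRS, holAt]
  | cons s γ ih =>
      rw [holRS_cons, ih]
      unfold holAt
      rw [List.map_cons, List.prod_cons, map_mul]
      cases s.fwd <;> simp

section Analytic

variable {𝔸 : Type*} [NormedRing 𝔸] [NormedAlgebra ℂ 𝔸] {E : Type*} [NormedAddCommGroup E] [NormedSpace ℂ E]

/-- [folklore] **HOLONOMY IS ANALYTIC IN ANALYTIC TWO-SIDED DATA** (a finite product). -/
theorem analyticAt_holRS {R S : E → PBond P j → 𝔸} {x : E} (hR : ∀ b, AnalyticAt ℂ (fun y => R y b) x)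
    (hS : ∀ b, AnalyticAt ℂ (fun y => S y b) x) (γ : List (LStep P j)) : AnalyticAt ℂ (fun y => holRS (R y) (S y) γ) x := by
  induction γ with
  | nil => simp only [holRS_nil]; exact analyticAt_const
  | cons s γ ih =>
      simp only [holRS_cons]
      refine AnalyticAt.mul ?_ ih
      cases s.fwd
      · simpa using hS s.bond
      · simpa using hR s.bond

/-- [folklore] … hence continuous there. -/
theorem continuousAt_holRS {R S : E → PBond P j → 𝔸} {x : E} (hR : ∀ b, AnalyticAt ℂ (fun y => R y b) x)
    (hS : ∀ b, AnalyticAt ℂ (fun y => S y b) x) (γ : List (LStep P j)) : ContinuousAt (fun y => holRS (R y) (S y) γ) x :=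
  (analyticAt_holRS hR hS γ).continuousAt

end Analytic

/-! ## §2 The complex (0.4) step on two-sided data and its real tie -/

section Words

variable {𝔸 : Type*} [Monoid 𝔸]

/-- [folklore] **THE (0.4) LOOP VARIABLES ON TWO-SIDED DATA** at the coarse bond `c`: the words `Γ ∪ [x,x′] ∪ (−Γ′) ∪ (−c)` of `BlockAveraging.loopHol`
(`walk (emb c₋) (loopWord L c.dir (off r) σ σ′)`) read by `holRS`. -/
def loopHolRS (R S : PBond P j → 𝔸) (c : PBond P (j + 1)) (i : Idx P) : 𝔸 :=
  holRS R S (walk (emb c.src) (loopWord P.L c.dir (off i.1) i.2.1 i.2.2))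

/-- [folklore] **THE AXIAL FACTOR ON TWO-SIDED DATA**: the straight walk of `L` steps from `emb c₋` (the tree's `axialAvg`, `axialAvg_eq_holAt_walk`). -/
def axialRS (R S : PBond P j → 𝔸) (c : PBond P (j + 1)) : 𝔸 :=
  holRS R S (walk (emb c.src) (List.replicate P.L (c.dir, true)))

/-- [folklore] Real tie of the loop variables: `loopHolRS (ι∘U) (ι∘U⁻¹) c i = ι (loopHol U c i)`. -/
theorem loopHolRS_hom_eq {G : Type*} [GaugeGroup G] (ι : G →* 𝔸) (U : GaugeField P j G) (c : PBond P (j + 1)) (i : Idx P) :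
    loopHolRS (fun b => ι (U b)) (fun b => ι (U b)⁻¹) c i = ι (loopHol U c i) :=
  holRS_hom_eq ι U _

/-- [folklore] Real tie of the axial factor: `axialRS (ι∘U) (ι∘U⁻¹) c = ι (axialAvg U c)`. -/
theorem axialRS_hom_eq {G : Type*} [GaugeGroup G] (ι : G →* 𝔸) (U : GaugeField P j G) (c : PBond P (j + 1)) :
    axialRS (fun b => ι (U b)) (fun b => ι (U b)⁻¹) c = ι (AveragingRT.axialAvg U c) := by
  rw [axialAvg_eq_holAt_walk]; exact holRS_hom_eq ι U _

end Words

section Step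

variable {𝔸 : Type*} [NormedRing 𝔸] [NormedAlgebra ℂ 𝔸]

/-- [folklore] **THE COMPLEX (0.4) CORRECTION FACTOR**: the exp-mean-log `eml` of the loop variables, with NO small-field guard (the complex step is used
inside the small window only; off it the value is whatever the series give). -/
def corrRS (R S : PBond P j → 𝔸) (c : PBond P (j + 1)) : 𝔸 := eml (loopHolRS R S c)

/-- [folklore] **THE COMPLEX (0.4) ONE-STEP AVERAGE** `corr · axial` on two-sided data. -/
def avgRS (R S : PBond P j → 𝔸) (c : PBond P (j + 1)) : 𝔸 := corrRS R S c * axialRS R S c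

/-- [folklore] **`eml` IS REINDEXING-INVARIANT ALONG ANY EQUIVALENCE OF INDEX TYPES** (a finite sum reindexed; the tree's `eml_comp_equiv` is the case of a
permutation of one type). -/
theorem eml_comp_equiv' {ι κ : Type*} [Fintype ι] [Fintype κ] (W : ι → 𝔸) (e : κ ≃ ι) : eml (W ∘ e) = eml W := by
  simp only [eml_eq_exp, Function.comp_apply]
  rw [Fintype.card_congr e, e.sum_comp (fun i => MatrixLog.mlog (W i))]

/-- [folklore] **REAL TIE OF THE CORRECTION FACTOR.**  For a small-loop average `ℰ` on `G` whose operation, read through the monoid hom `ι`, IS the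
exp-mean-log on `ℰ`-small families (`hE` — DISPLAYED; discharged for `SU(n)` below), and a field `U` small at `c` (`Small ℰ U c`), the complex correction
factor of `(ι∘U, ι∘U⁻¹)` IS `ι` of the (0.4) correction factor `BlockAveraging.corr ℰ U c`. -/
theorem corrRS_hom_eq_of_small {G : Type*} [GaugeGroup G] (ℰ : LoopAverage G) (ι : G →* 𝔸)
    (hE : ∀ {m : ℕ} (W : Fin (m + 1) → G), (∀ i, dist1 (W i) < ℰ.δ) → ι (ℰ.E W) = eml fun i => ι (W i))
    {U : GaugeField P j G} {c : PBond P (j + 1)} (hU : Small ℰ U c) :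
    corrRS (fun b => ι (U b)) (fun b => ι (U b)⁻¹) c = ι (corr ℰ U c) := by
  unfold corr
  rw [if_pos hU, LoopAverage.avg, hE (loopHol U c ∘ (LoopAverage.enum (Idx P)).symm) (fun i => hU _), corrRS]
  have h : (fun i => ι ((loopHol U c ∘ (LoopAverage.enum (Idx P)).symm) i)) =
      (fun i => ι (loopHol U c i)) ∘ (LoopAverage.enum (Idx P)).symm := rfl
  rw [h, eml_comp_equiv']
  congr 1
  funext i
  exact loopHolRS_hom_eq ι U c i

/-- [folklore] **REAL TIE OF THE STEP**: under the same hypotheses the complex (0.4) average of `(ι∘U, ι∘U⁻¹)` IS `ι` of the (0.4) average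
`(blockAvg ℰ).avg U c = corr ℰ U c * axialAvg U c`. -/
theorem avgRS_hom_eq_of_small {G : Type*} [GaugeGroup G] (ℰ : LoopAverage G) (ι : G →* 𝔸)
    (hE : ∀ {m : ℕ} (W : Fin (m + 1) → G), (∀ i, dist1 (W i) < ℰ.δ) → ι (ℰ.E W) = eml fun i => ι (W i))
    {U : GaugeField P j G} {c : PBond P (j + 1)} (hU : Small ℰ U c) :
    avgRS (fun b => ι (U b)) (fun b => ι (U b)⁻¹) c = ι ((blockAvg ℰ).avg U c) := by
  rw [BlockAveraging.blockAvg_avg, avgFun, map_mul, avgRS, corrRS_hom_eq_of_small ℰ ι hE hU, axialRS_hom_eq]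

end Step

/-! ### The `SU(n)` discharge: `ι := fundamentalRep`, `ℰ := expMeanLogSU` -/

section SU

variable {n : Type} [Fintype n] [DecidableEq n] [Nonempty n]

/-- [folklore] **`hE` DISCHARGED FOR `SU(n)`**: through the fundamental representation the printed small-loop average of record `expMeanLogSU` IS `eml`
on its small families (tree `coe_ESU_of_small`; `dist1 = ‖· − 1‖` on `SU(n)` definitionally). -/
theorem fundamentalRep_expMeanLogSU_E {m : ℕ} (W : Fin (m + 1) → Matrix.specialUnitaryGroup n ℂ) (hW : ∀ i, dist1 (W i) < (expMeanLogSU (n := n)).δ) :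
    fundamentalRep n ((expMeanLogSU (n := n)).E W) = eml fun i => fundamentalRep n (W i) :=
  coe_ESU_of_small hW

/-- [folklore] **ON SMALL FIELDS THE COMPLEX STEP IS THE (0.4) AVERAGE OF RECORD** (`SU(n)`, `blockAvg expMeanLogSU`, read through `fundamentalRep`). -/
theorem avgRS_fundamentalRep_eq_blockAvg {U : GaugeField P j (Matrix.specialUnitaryGroup n ℂ)} {c : PBond P (j + 1)}
    (hU : Small (expMeanLogSU (n := n)) U c) :
    avgRS (fun b => fundamentalRep n (U b)) (fun b => fundamentalRep n (U b)⁻¹) c = fundamentalRep n ((blockAvg (expMeanLogSU (n := n))).avg U c) :=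
  avgRS_hom_eq_of_small _ _ (fun W hW => fundamentalRep_expMeanLogSU_E W hW) hU

end SU

/-! ## §3 Holomorphy of the complex step along analytic two-sided families; the fine-field slice -/

section Holo

variable {𝔸 : Type*} [NormedRing 𝔸] [NormedAlgebra ℂ 𝔸] [CompleteSpace 𝔸] {E : Type*} [NormedAddCommGroup E] [NormedSpace ℂ E]

/-- [folklore] **THE CORRECTION FACTOR IS HOLOMORPHIC** along an analytic two-sided family at every parameter whose loop variables are 1-small
(`ExpMeanLog.analyticAt_eml` composed with §1). -/
theorem analyticAt_corrRS {R S : E → PBond P j → 𝔸} {x : E} (hR : ∀ b, AnalyticAt ℂ (fun y => R y b) x) (hS : ∀ b, AnalyticAt ℂ (fun y => S y b) x)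
    (c : PBond P (j + 1)) (hsmall : ∀ i, ‖loopHolRS (R x) (S x) c i - 1‖ < 1) : AnalyticAt ℂ (fun y => corrRS (R y) (S y) c) x := by
  have hW : AnalyticAt ℂ (fun y => fun i : Idx P => loopHolRS (R y) (S y) c i) x := analyticAt_pi_iff.2 fun i => analyticAt_holRS hR hS _
  exact (analyticAt_eml hsmall).comp_of_eq hW rfl

/-- [folklore] **THE COMPLEX (0.4) STEP IS HOLOMORPHIC** along such a family. -/
theorem analyticAt_avgRS {R S : E → PBond P j → 𝔸} {x : E} (hR : ∀ b, AnalyticAt ℂ (fun y => R y b) x) (hS : ∀ b, AnalyticAt ℂ (fun y => S y b) x)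
    (c : PBond P (j + 1)) (hsmall : ∀ i, ‖loopHolRS (R x) (S x) c i - 1‖ < 1) : AnalyticAt ℂ (fun y => avgRS (R y) (S y) c) x :=
  (analyticAt_corrRS hR hS c hsmall).mul (analyticAt_holRS hR hS _)

variable {G : Type*} [GaugeGroup G] (ι : G →* 𝔸)

/-- [folklore] **THE FINE-FIELD SLICE, `R`-side**: `z ↦ exp(z·H_b) · ι(U_b)` (left perturbation, the convention of the substrate's `expChart`). -/
def sliceR (U : GaugeField P j G) (H : PBond P j → 𝔸) (z : ℂ) (b : PBond P j) : 𝔸 := NormedSpace.exp (z • H b) * ι (U b)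

/-- [folklore] **THE FINE-FIELD SLICE, `S`-side**: `z ↦ ι(U_b)⁻¹ · exp(−z·H_b)` (the displayed inverse side; no inversion of a variable). -/
def sliceS (U : GaugeField P j G) (H : PBond P j → 𝔸) (z : ℂ) (b : PBond P j) : 𝔸 := ι (U b)⁻¹ * NormedSpace.exp (-(z • H b))

omit [CompleteSpace 𝔸] in
/-- [folklore] At `z = 0` the slice reads the real field. -/
@[simp] theorem sliceR_zero (U : GaugeField P j G) (H : PBond P j → 𝔸) : sliceR ι U H 0 = fun b => ι (U b) := by
  funext b; simp [sliceR]

omit [CompleteSpace 𝔸] in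
/-- [folklore] At `z = 0` the inverse side reads the real inverse field. -/
@[simp] theorem sliceS_zero (U : GaugeField P j G) (H : PBond P j → 𝔸) : sliceS ι U H 0 = fun b => ι (U b)⁻¹ := by
  funext b; simp [sliceS]

/-- [folklore] **THE TWO SIDES ARE INVERSE TO EACH OTHER ALONG THE SLICE**: `sliceR z b * sliceS z b = 1` — `exp(zH)·ι(U)·ι(U⁻¹)·exp(−zH) = 1`
(`ι` a monoid hom, `NormedSpace.exp` of the commuting pair `zH`, `−zH` via the tree's `mem_eball_expSeries_radius`).  This is what makes `S` the
inverse side OFF the real axis (no inversion of a variable is ever performed). -/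
theorem sliceR_mul_sliceS (U : GaugeField P j G) (H : PBond P j → 𝔸) (z : ℂ) (b : PBond P j) : sliceR ι U H z b * sliceS ι U H z b = 1 := by
  have hexp : NormedSpace.exp (z • H b) * NormedSpace.exp (-(z • H b)) = 1 := by
    rw [← NormedSpace.exp_add_of_commute_of_mem_ball ((Commute.refl (z • H b)).neg_right)
      (Literature.Analysis.Complex.mem_eball_expSeries_radius _) (Literature.Analysis.Complex.mem_eball_expSeries_radius _),
      add_neg_cancel, NormedSpace.exp_zero]
  have hU : ι (U b) * ι (U b)⁻¹ = 1 := by rw [← map_mul, mul_inv_cancel, map_one]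
  calc sliceR ι U H z b * sliceS ι U H z b
      = NormedSpace.exp (z • H b) * (ι (U b) * ι (U b)⁻¹) * NormedSpace.exp (-(z • H b)) := by
        simp only [sliceR, sliceS, mul_assoc]
    _ = 1 := by rw [hU, mul_one, hexp]

/-- [folklore] The `R`-side of the slice is entire in `z`, bond by bond. -/
theorem analyticAt_sliceR (U : GaugeField P j G) (H : PBond P j → 𝔸) (z₀ : ℂ) (b : PBond P j) :
    AnalyticAt ℂ (fun z => sliceR ι U H z b) z₀ := by
  have h1 : AnalyticAt ℂ (fun z : ℂ => z • H b) z₀ := analyticAt_id.smul analyticAt_const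
  have h2 : AnalyticAt ℂ (fun z : ℂ => NormedSpace.exp (z • H b)) z₀ := (NormedSpace.exp_analytic _).fun_comp_of_eq h1 rfl
  exact h2.mul analyticAt_const

/-- [folklore] The `S`-side of the slice is entire in `z`, bond by bond. -/
theorem analyticAt_sliceS (U : GaugeField P j G) (H : PBond P j → 𝔸) (z₀ : ℂ) (b : PBond P j) :
    AnalyticAt ℂ (fun z => sliceS ι U H z b) z₀ := by
  have h1 : AnalyticAt ℂ (fun z : ℂ => -(z • H b)) z₀ := (analyticAt_id.smul analyticAt_const).neg
  have h2 : AnalyticAt ℂ (fun z : ℂ => NormedSpace.exp (-(z • H b))) z₀ := (NormedSpace.exp_analytic _).fun_comp_of_eq h1 rfl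
  exact analyticAt_const.mul h2

/-- [folklore] **THE COMPLEX (0.4) AVERAGE OF THE FINE-FIELD SLICE IS HOLOMORPHIC IN `z`** at every `z₀` where the slice's loop variables at `c` are
1-small. -/
theorem analyticAt_avgRS_slice (U : GaugeField P j G) (H : PBond P j → 𝔸) (c : PBond P (j + 1)) {z₀ : ℂ}
    (hsmall : ∀ i, ‖loopHolRS (sliceR ι U H z₀) (sliceS ι U H z₀) c i - 1‖ < 1) :
    AnalyticAt ℂ (fun z => avgRS (sliceR ι U H z) (sliceS ι U H z) c) z₀ :=
  analyticAt_avgRS (fun b => analyticAt_sliceR ι U H z₀ b) (fun b => analyticAt_sliceS ι U H z₀ b) c hsmall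

/-- [folklore] **… IN PARTICULAR AT `z₀ = 0` ON SMALL FIELDS**: if `ι` reads `dist1` as `‖· − 1‖` (`hdist`, displayed; `rfl` on `SU(n)`) and `U` is
`ℰ`-small at `c` with `ℰ.δ ≤ 1`, the complex (0.4) average of the slice is holomorphic at the real field. -/
theorem analyticAt_avgRS_slice_zero (ℰ : LoopAverage G) (hδ : ℰ.δ ≤ 1) (hdist : ∀ g : G, ‖ι g - 1‖ = dist1 g) (U : GaugeField P j G)
    (H : PBond P j → 𝔸) {c : PBond P (j + 1)} (hU : Small ℰ U c) :
    AnalyticAt ℂ (fun z => avgRS (sliceR ι U H z) (sliceS ι U H z) c) 0 := by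
  refine analyticAt_avgRS_slice ι U H c fun i => ?_
  rw [sliceR_zero, sliceS_zero, loopHolRS_hom_eq, hdist]
  exact (hU i).trans_le hδ

end Holo

/-! ## §4 The one-step chart coordinate of the complex average (W-24a's logarithmic chart BY NAME) -/

section Chart

open Summit.QuantumFields.BalabanUV.T4Continuum.SubstrateExpChartLog (logChart logChart_apply analyticAt_logChart_apply)

/-- [folklore] Coarse bond data re-indexed as `Fin d → Site → Matrix` — the shape W-24a's one-level `logChart` reads. -/
def asLevel {o : Type*} (f : PBond P (j + 1) → Matrix o o ℂ) : Fin P.d → Site P (j + 1) → Matrix o o ℂ := fun ν y => f ⟨y, ν⟩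

/-- [folklore] `asLevel` unfolds (`rfl`). -/
@[simp] theorem asLevel_apply {o : Type*} (f : PBond P (j + 1) → Matrix o o ℂ) (ν : Fin P.d) (y : Site P (j + 1)) :
    asLevel f ν y = f ⟨y, ν⟩ := rfl

variable {o : Type*} [Fintype o] [DecidableEq o] {G : Type*} [GaugeGroup G]

/-- [folklore] **THE ONE-STEP CHART COORDINATE** of the complex (0.4) average of the fine-field slice at `z`, RELATIVE TO THE REAL AVERAGE `ι ∘ M(U)`:
`log( M̃(slice z)(c) · (ι M(U)(c))⁻¹ )` bond by bond (W-24a `logChart`). -/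
def stepCoord (ℰ : LoopAverage G) (ι : G →* Matrix o o ℂ) (U : GaugeField P j G) (H : PBond P j → Matrix o o ℂ) (z : ℂ) :
    Fin P.d → Site P (j + 1) → Matrix o o ℂ :=
  logChart (asLevel fun c => ι ((blockAvg ℰ).avg U c)) (asLevel fun c => avgRS (sliceR ι U H z) (sliceS ι U H z) c)

/-- [folklore] At `z = 0` the complex average of the slice IS the real average (the tie of §2, the slice read at `0`). -/
theorem avgRS_slice_zero (ℰ : LoopAverage G) (ι : G →* Matrix o o ℂ)
    (hE : ∀ {m : ℕ} (W : Fin (m + 1) → G), (∀ i, dist1 (W i) < ℰ.δ) → ι (ℰ.E W) = eml fun i => ι (W i))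
    (U : GaugeField P j G) (H : PBond P j → Matrix o o ℂ) {c : PBond P (j + 1)} (hU : Small ℰ U c) :
    avgRS (sliceR ι U H 0) (sliceS ι U H 0) c = ι ((blockAvg ℰ).avg U c) := by
  rw [sliceR_zero, sliceS_zero]; exact avgRS_hom_eq_of_small ℰ ι hE hU

/-- [folklore] **LETTER (1) AT ONE STEP**: the chart coordinate vanishes at `z = 0` at every coarse bond where `U` is small (`ι` unitary-valued, so the
real average is invertible). -/
theorem stepCoord_zero_apply (ℰ : LoopAverage G) (ι : G →* Matrix o o ℂ) (hι : ∀ g, ι g ∈ Matrix.unitaryGroup o ℂ)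
    (hE : ∀ {m : ℕ} (W : Fin (m + 1) → G), (∀ i, dist1 (W i) < ℰ.δ) → ι (ℰ.E W) = eml fun i => ι (W i))
    (U : GaugeField P j G) (H : PBond P j → Matrix o o ℂ) {ν : Fin P.d} {y : Site P (j + 1)} (hU : Small ℰ U ⟨y, ν⟩) :
    stepCoord ℰ ι U H 0 ν y = 0 := by
  rw [stepCoord, logChart_apply]
  show MatrixLog.mlog (avgRS (sliceR ι U H 0) (sliceS ι U H 0) ⟨y, ν⟩ * (ι ((blockAvg ℰ).avg U ⟨y, ν⟩))⁻¹) = 0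
  rw [avgRS_slice_zero ℰ ι hE U H hU,
    Matrix.mul_nonsing_inv _ (SubstrateTransporterSpecies.isUnit_det_of_mem_unitaryGroup (hι _)), MatrixLog.mlog_one]

/-- [folklore] **LETTER (2′) AT ONE STEP**: the chart coordinate is HOLOMORPHIC at `z = 0`, bond by bond (`ℰ.δ ≤ 1`, `‖ι g − 1‖ = dist1 g`, `ι`
unitary-valued, `U` small at the bond): W-24a `analyticAt_logChart_apply` ∘ §3 `analyticAt_avgRS_slice_zero`, the log window at `0` being the point `1`. -/
theorem analyticAt_stepCoord_zero (ℰ : LoopAverage G) (hδ : ℰ.δ ≤ 1) (ι : G →* Matrix o o ℂ) (hι : ∀ g, ι g ∈ Matrix.unitaryGroup o ℂ)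
    (hdist : ∀ g : G, ‖ι g - 1‖ = dist1 g)
    (hE : ∀ {m : ℕ} (W : Fin (m + 1) → G), (∀ i, dist1 (W i) < ℰ.δ) → ι (ℰ.E W) = eml fun i => ι (W i))
    (U : GaugeField P j G) (H : PBond P j → Matrix o o ℂ) {ν : Fin P.d} {y : Site P (j + 1)} (hU : Small ℰ U ⟨y, ν⟩) :
    AnalyticAt ℂ (fun z => stepCoord ℰ ι U H z ν y) 0 := by
  refine analyticAt_logChart_apply (T := fun z => asLevel fun c => avgRS (sliceR ι U H z) (sliceS ι U H z) c) ?_ ?_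
  · exact analyticAt_avgRS_slice_zero ι ℰ hδ hdist U H hU
  · show ‖avgRS (sliceR ι U H 0) (sliceS ι U H 0) ⟨y, ν⟩ * (ι ((blockAvg ℰ).avg U ⟨y, ν⟩))⁻¹ - 1‖ < 1
    rw [avgRS_slice_zero ℰ ι hE U H hU, Matrix.mul_nonsing_inv _ (SubstrateTransporterSpecies.isUnit_det_of_mem_unitaryGroup (hι _)),
      sub_self, norm_zero]
    exact one_pos

end Chart

/-! ### The `SU(n)` discharge of §4: every hypothesis PROVED at the averaging of record -/

section ChartSU

variable {n : Type} [Fintype n] [DecidableEq n] [Nonempty n]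

/-- [folklore] The radius of `expMeanLogSU` is at most `1` (it is `min (1∕3) (π∕N)`). -/
theorem expMeanLogSU_δ_le_one : (expMeanLogSU (n := n)).δ ≤ 1 := by
  rw [ExpMeanLog.expMeanLogSU_δ]; exact (min_le_left _ _).trans (by norm_num)

/-- [folklore] **LETTER (1) AT ONE STEP, `SU(n)`, HYPOTHESIS-FREE but for smallness**: at `ℰ := expMeanLogSU`, `ι := fundamentalRep n`. -/
theorem stepCoord_zero_apply_SU (U : GaugeField P j (Matrix.specialUnitaryGroup n ℂ)) (H : PBond P j → Matrix n n ℂ) {ν : Fin P.d}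
    {y : Site P (j + 1)} (hU : Small (expMeanLogSU (n := n)) U ⟨y, ν⟩) :
    stepCoord (expMeanLogSU (n := n)) (fundamentalRep n) U H 0 ν y = 0 :=
  stepCoord_zero_apply (expMeanLogSU (n := n)) (fundamentalRep n)
    (fun g => Literature.MathematicalPhysics.QuantumLattice.fundamentalRep_mem_unitaryGroup g)
    (fun W hW => fundamentalRep_expMeanLogSU_E W hW) U H hU

/-- [folklore] **LETTER (2′) AT ONE STEP, `SU(n)`, HYPOTHESIS-FREE but for smallness**: the chart coordinate of the complex (0.4) average of the
fine-field slice of a small `SU(n)` field is holomorphic at `z = 0`. -/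
theorem analyticAt_stepCoord_zero_SU (U : GaugeField P j (Matrix.specialUnitaryGroup n ℂ)) (H : PBond P j → Matrix n n ℂ) {ν : Fin P.d}
    {y : Site P (j + 1)} (hU : Small (expMeanLogSU (n := n)) U ⟨y, ν⟩) :
    AnalyticAt ℂ (fun z => stepCoord (expMeanLogSU (n := n)) (fundamentalRep n) U H z ν y) 0 :=
  analyticAt_stepCoord_zero (expMeanLogSU (n := n)) expMeanLogSU_δ_le_one (fundamentalRep n)
    (fun g => Literature.MathematicalPhysics.QuantumLattice.fundamentalRep_mem_unitaryGroup g)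
    (fun _ => rfl) (fun W hW => fundamentalRep_expMeanLogSU_E W hW) U H hU

end ChartSU

end Summit.QuantumFields.BalabanUV.T4Continuum.SubstrateComplexBlockAvg

end
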